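import Literature.MathematicalPhysics.QuantumFieldTheory.Balaban1983to89.B16StepFactorsPrinted

/-!
# `Balaban1983to89.B16PrepFactorsLargest383` — [Balaban1989LargeFieldII] p. 383 after (1.78): «This is the largest factor among all
the small factors we have obtained from the large field characteristic functions in the preparatory steps», PROVED kind by kind as
real arithmetic between the printed right members of pp. 381–382 and the ROUNDED letter `exp(−R_j^{−d−5}p₁²(g_j))`

statement-level skeleton of published theorems with citation tags; proofs where landed; nothing here is a claim about
the Yang–Mills mass gap

HONEST FRAMING.  Theorems of REAL ARITHMETIC only (no `def`, no `Prop` minted, nothing cited as a hypothesis); nothing of Bałaban's is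
asserted, valued or discharged (the manuscript is UNDER AUDIT; 0∕13 main theorems of the series proved in the tree).  Companion leaf of
INTERFACE REQUEST NE7b IR-100-2 (`B16StepFactorsPrinted`, p344269; typist = gaps seat ne6) written after the cell's located objection
π-gapsne6-g4-2 (pub-balaban journal l.48559): of the FIVE preparatory large-field factors pp. 381–382 list, print bounds every one by
ONE uniform member — the ROUNDED right member `exp(−R_j^{−d−5}p₁²(g_j))` of the display after (1.78) —, and THAT is the per-renewed-
component sentence (P) of `B16StepFactorsPrinted.StepDisplaysAt`; the UNROUNDED left member of that display (case 2 of `1 − χ′`) is NOT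
a bound for the case-1 factor of p. 382 once `R_j` is large.  This file proves the uniform comparison, with every «g_j sufficiently
small» ∕ constants relation print uses silently made an explicit hypothesis (`1 ≤ R_j`; `1 ≤ γ₀A₁²`; `48 ≤ A₁` — cell ledger GAPS
G-B16-07 R4, as in `B16Sect1Statements.prep382_case1_factor`; `p₁ ≤ p₀` — [Balaban1989LargeFieldI] p. 183 l. 1 «and p₁ < p₀»; the
largeness `12(d+3)(100M(L+1)N^{β₀})^{d+2} ≤ γ₀A₁²R_j³` of `B16Sect1Kernels.lfFactor178_of_large`; for the two `p₀`-kinds the exponent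
comparison `R_j^{−d−5}p₁² ≤ A₁²p₀²`, discharged EITHER from «p₁ < p₀» OR from `2p₁ − (d+5)r₀ ≤ 2p₀` in the ℓ-dictionary), and (§3) the
junction: carriers
whose every primed component carries ONE of the five printed factors satisfy (P) letter for letter.  The printed right members are
those typed (and, for their own printed «≦», PROVED) in `B16Sect1Statements` §12 — `prep381_chi_n`, `prep381_chi'`, `prep381_chiΛ`,
`prep382_case1_factor` — and `B16Sect1Kernels.lfFactor178`; nothing of them is restated, the members are matched token for token so
a consumer chains `.trans`.

Printed context, verbatim (renders `b2b-balaban-ref1/pages/1989-cmp122-large-field-II/…-p027∕p028∕p029-x2.png` = pp. 381–383, READ AS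
IMAGES by this seat's lineage 2026-08-22∕23).  p. 381 ¶ 3: *"Besides the above large field factors there are also the factors arising in
the preparatory steps to the 𝐑-operation, and described in Sect. 1 [IV]. These factors are connected with components of a large field
region Z_j, which satisfies the conditions (i), (ii) at the beginning of Sect. 1 [IV]. Thus, if one of the functions 1 − χ_j^{(n)} is
introduced in such a component, we get a factor … ≦ exp(−A₁²p₀²(g_j)). The function 1 − χ′_m … yields the factor … ≦ exp(−γ₀A₁²p₁²(g_j)).
… The function 1 − χ_{j,Λ} yields the factor … ≦ exp(−A₁²p₀²(g_j))"*; p. 382 (case 1 of `1 − χ′`): *"Then the Wilson action yields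
the factor exp(−¼(1∕g_j²)(24R_j⁴)⁻²δ′_j²) = exp(−A₁²48⁻²R_j⁻⁸p₁²(g_j)) ≦ exp(−R_j⁻⁸p₁²(g_j))"*; p. 383 (case 2, after (1.78)): *"… yield
the following large field factor: exp(−½γ₀[6(d + 3)(100M(L + 1)N^{β₀}R_j)^{d+2}]⁻¹A₁²p₁(g_j)) < exp(−R_j^{−d−5}p₁²(g_j)). This is the
largest factor among all the small factors we have obtained from the large field characteristic functions in the preparatory steps.
We assume that 2p₁ − (d + 5)r₀ > p₀, and we estimate the factors by exp(−p₀(g_j))."*  Dictionary: [Balaban1988Convergent] (2.4) p. 255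
«ε_j = g_jA₀(log g_j⁻²)^{p₀} = g_jp₀(g_j)»; [Balaban1989LargeFieldI] p. 183 l. 1 «δ′_j = g_jA₁p₁(g_j), p₁(g_j) = (log g_j⁻²)^{p₁}, and
p₁ < p₀».  The case-1 exponent `R_j⁻⁸` is printed at `d = 4`; it is kept as printed and compared under `3 ≤ d` (`8 ≤ d + 5`).  Rung
(B)+1 context only: NOT the continuum limit, NOT infinite volume, NOT a mass gap, NOT Clay.  BY-NAME EFFECT ON THE ROW's WALL: NONE
(a supplier of (P) per component kind for the consumer (A1c)); NE7b NOT PRINTED ∕ NOT PROVED; spine 0∕9.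
-/

namespace Literature.MathematicalPhysics.QuantumFieldTheory.Balaban1983to89.B16PrepFactorsLargest383

open Literature.MathematicalPhysics.QuantumFieldTheory.Balaban1983to89
open Literature.MathematicalPhysics.QuantumFieldTheory.Balaban1983to89.B16StepFactorsPrinted

noncomputable section

/-! ## §1 Each printed right member against the rounded letter `exp(−R_j^{−d−5}p₁²(g_j))` -/

/-- The comparison pattern: a factor `exp(−a·p₁²)` whose coefficient dominates the rounded one, `R^{−(d+5)} ≤ a`, is at most
`exp(−R^{−(d+5)}p₁²)`.  Real arithmetic. [cite: Balaban1989LargeFieldII, p.383 (after (1.78))] -/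
theorem exp_le_largest_of_coeff {a R p₁g : ℝ} {d : ℕ} (h : (R ^ (d + 5))⁻¹ ≤ a) :
    Real.exp (-(a * p₁g ^ 2)) ≤ Real.exp (-(R ^ (d + 5))⁻¹ * p₁g ^ 2) := by
  rw [Real.exp_le_exp]
  nlinarith [mul_le_mul_of_nonneg_right h (sq_nonneg p₁g)]

/-- The rounded coefficient is at most one: `R_j^{−(d+5)} ≤ 1` for `R_j ≥ 1` ((2.5) [III]: «R_j is the smallest number of the form Lʳ such,
that R_j ≧ (log g_j⁻²)ʳ», so `R_j = Lʳ ≥ 1` — lit-balaban r13's letter, journal l.48741). [cite: Balaban1988Convergent, (2.5) p.255] -/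
theorem inv_Rpow_le_one {R : ℝ} (hR : 1 ≤ R) (n : ℕ) : (R ^ n)⁻¹ ≤ 1 :=
  inv_le_one_of_one_le₀ (one_le_pow₀ hR)

/-- **p. 381, `1 − χ′_m`**: its printed right member `exp(−γ₀A₁²p₁²(g_j))` (`B16Sect1Statements.prep381_chi'`) is at most the
largest factor `exp(−R_j^{−d−5}p₁²(g_j))`, for `R_j ≥ 1` and `γ₀A₁² ≥ 1` (print: «we may take γ₀ = 1∕2» p. 380, `A₁ ≥ 48` —
cell ledger GAPS G-B16-07 R4). [cite: Balaban1989LargeFieldII, p.381 (after (1.76)) with p.383 (after (1.78))] -/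
theorem chi'm_le_largest {γ₀ A₁ p₁g R : ℝ} {d : ℕ} (hR : 1 ≤ R) (hγA : 1 ≤ γ₀ * A₁ ^ 2) :
    Real.exp (-(γ₀ * A₁ ^ 2 * p₁g ^ 2)) ≤ Real.exp (-(R ^ (d + 5))⁻¹ * p₁g ^ 2) :=
  exp_le_largest_of_coeff ((inv_Rpow_le_one hR _).trans hγA)

/-- **p. 381, `1 − χ_j^{(n)}` and `1 − χ_{j,Λ}`**: their common printed right member `exp(−A₁²p₀²(g_j))` (`prep381_chi_n`,
`prep381_chiΛ`) is at most the largest factor `exp(−R_j^{−d−5}p₁²(g_j))` as soon as the exponents compare,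
`R_j^{−d−5}p₁²(g_j) ≤ A₁²p₀²(g_j)` (`hcmp` — discharged from the printed order «p₁ < p₀» by `cmp_of_order` ∕ `p₁sq_le_of_profiles`,
or from the exponent bookkeeping `2p₁ − (d+5)r₀ ≤ 2p₀` by `cmp_of_exponents`). [cite: Balaban1989LargeFieldII, p.381 (after (1.76)) with p.383 (after (1.78))] -/
theorem chi_n_le_largest {A₁ p₀g p₁g R : ℝ} {d : ℕ} (hcmp : (R ^ (d + 5))⁻¹ * p₁g ^ 2 ≤ A₁ ^ 2 * p₀g ^ 2) :
    Real.exp (-(A₁ ^ 2 * p₀g ^ 2)) ≤ Real.exp (-(R ^ (d + 5))⁻¹ * p₁g ^ 2) := by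
  rw [Real.exp_le_exp]
  linarith

/-- `hcmp` of `chi_n_le_largest` from the ORDER of the profiles: `R_j ≥ 1` and `p₁²(g_j) ≤ A₁²p₀²(g_j)` (`p₁sq_le_of_profiles`).
[cite: Balaban1989LargeFieldII, p.383 (after (1.78))] -/
theorem cmp_of_order {A₁ p₀g p₁g R : ℝ} {d : ℕ} (hR : 1 ≤ R) (h01 : p₁g ^ 2 ≤ A₁ ^ 2 * p₀g ^ 2) :
    (R ^ (d + 5))⁻¹ * p₁g ^ 2 ≤ A₁ ^ 2 * p₀g ^ 2 := by
  have := mul_le_mul_of_nonneg_right (inv_Rpow_le_one hR (d + 5)) (sq_nonneg p₁g)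
  linarith

/-- The profiles' relation behind `cmp_of_order`: with `p₁(g_j) = ℓ^{p₁}`, `p₀(g_j) = A₀ℓ^{p₀}` (`ℓ = log g_j⁻² ≥ 1`), the
printed order of exponents «p₁ < p₀» ([Balaban1989LargeFieldI] p. 183 l. 1; weakly) and `A₀, A₁ ≥ 1` give `p₁²(g_j) ≤ A₁²p₀²(g_j)`
(`A₀, A₁ ≥ 1` are constants relations the consumer discharges from the cell ledger: `A₁ ≥ 48` = GAPS G-B16-07 R4, `A₀ ≥ A₁` via R2).
Real arithmetic (`rpow`). [cite: Balaban1989LargeFieldI, p.183 l.1] -/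
theorem p₁sq_le_of_profiles {ℓ p₀ p₁ A₀ A₁ p₀g p₁g : ℝ} (hℓ : 1 ≤ ℓ) (hp : p₁ ≤ p₀) (hA₀ : 1 ≤ A₀) (hA₁ : 1 ≤ A₁)
    (hp₀ : p₀g = A₀ * ℓ ^ p₀) (hp₁ : p₁g = ℓ ^ p₁) : p₁g ^ 2 ≤ A₁ ^ 2 * p₀g ^ 2 := by
  subst hp₀ hp₁
  have h0 : 0 ≤ ℓ ^ p₁ := Real.rpow_nonneg (by linarith) _
  have h1 : ℓ ^ p₁ ≤ ℓ ^ p₀ := Real.rpow_le_rpow_of_exponent_le hℓ hp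
  have h2 : ℓ ^ p₀ ≤ A₀ * ℓ ^ p₀ := le_mul_of_one_le_left (h0.trans h1) hA₀
  have h3 : (ℓ ^ p₁) ^ 2 ≤ (A₀ * ℓ ^ p₀) ^ 2 := pow_le_pow_left₀ h0 (h1.trans h2) 2
  have h4 : (1 : ℝ) ≤ A₁ ^ 2 := one_le_pow₀ hA₁
  nlinarith [h3, h4, sq_nonneg (A₀ * ℓ ^ p₀)]

/-- `hcmp` of `chi_n_le_largest` from the EXPONENT BOOKKEEPING, in the `ℓ = log g_j⁻²` dictionary of
`B16Sect1Kernels.exp_lfFactor_le_exp_neg_p0` ∕ `B16StepFactorsRounding.hround_of_largeness`: `p₁(g_j) = ℓ^{p₁}`, `p₀(g_j) = A₀ℓ^{p₀}`,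
the LOWER end of (2.5) [III] `R_j ≥ ℓ^{r₀}` («R_j ≧ (log g_j⁻²)ʳ»), `ℓ ≥ 1`, `A₀, A₁ ≥ 1`, and `2p₁ − (d+5)r₀ ≤ 2p₀` — implied by the
printed order «p₁ < p₀» (then `2p₁ < 2p₀`), but also met by exponent choices with `p₁ ≥ p₀` (e.g. a census tuple with
`2p₁ = p₀ + (d+5)r₀ + η`, `η ≤ p₀`).  Real arithmetic (`rpow`). [cite: Balaban1989LargeFieldII, p.383 (after (1.78))] -/
theorem cmp_of_exponents {ℓ p₀ p₁ r₀ A₀ A₁ p₀g p₁g R : ℝ} {d : ℕ} (hℓ : 1 ≤ ℓ) (hp₀ : p₀g = A₀ * ℓ ^ p₀) (hp₁ : p₁g = ℓ ^ p₁)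
    (hRℓ : ℓ ^ r₀ ≤ R) (hA₀ : 1 ≤ A₀) (hA₁ : 1 ≤ A₁) (hexp : 2 * p₁ - (d + 5) * r₀ ≤ 2 * p₀) :
    (R ^ (d + 5))⁻¹ * p₁g ^ 2 ≤ A₁ ^ 2 * p₀g ^ 2 := by
  subst hp₀ hp₁
  have hℓ0 : 0 < ℓ := by linarith
  have hℓr : 0 < ℓ ^ r₀ := Real.rpow_pos_of_pos hℓ0 _
  have hR0 : 0 < R := lt_of_lt_of_le hℓr hRℓ
  -- `R^{−(d+5)} ≤ ℓ^{−(d+5)r₀}`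
  have h1 : (R ^ (d + 5))⁻¹ ≤ ((ℓ ^ r₀) ^ (d + 5))⁻¹ :=
    inv_anti₀ (pow_pos hℓr _) (pow_le_pow_left₀ hℓr.le hRℓ _)
  have e1 : ((ℓ ^ r₀) ^ (d + 5))⁻¹ * (ℓ ^ p₁) ^ 2 = ℓ ^ (2 * p₁ - (d + 5) * r₀) := by
    rw [← Real.rpow_natCast (ℓ ^ r₀) (d + 5), ← Real.rpow_mul hℓ0.le, ← Real.rpow_neg hℓ0.le,
      ← Real.rpow_natCast (ℓ ^ p₁) 2, ← Real.rpow_mul hℓ0.le, ← Real.rpow_add hℓ0]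
    congr 1
    push_cast
    ring
  have e2 : (A₀ * ℓ ^ p₀) ^ 2 = A₀ ^ 2 * ℓ ^ (2 * p₀) := by
    rw [mul_pow, ← Real.rpow_natCast (ℓ ^ p₀) 2, ← Real.rpow_mul hℓ0.le]
    congr 1
    push_cast
    ring_nf
  have h2 : ℓ ^ (2 * p₁ - (d + 5) * r₀) ≤ ℓ ^ (2 * p₀) := Real.rpow_le_rpow_of_exponent_le hℓ hexp
  have hsq : 0 ≤ (ℓ ^ p₁) ^ 2 := sq_nonneg _
  have h3 : (R ^ (d + 5))⁻¹ * (ℓ ^ p₁) ^ 2 ≤ ℓ ^ (2 * p₀) := by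
    calc (R ^ (d + 5))⁻¹ * (ℓ ^ p₁) ^ 2 ≤ ((ℓ ^ r₀) ^ (d + 5))⁻¹ * (ℓ ^ p₁) ^ 2 :=
          mul_le_mul_of_nonneg_right h1 hsq
      _ = ℓ ^ (2 * p₁ - (d + 5) * r₀) := e1
      _ ≤ ℓ ^ (2 * p₀) := h2
  have h4 : (1 : ℝ) ≤ A₁ ^ 2 * A₀ ^ 2 := one_le_mul_of_one_le_of_one_le (one_le_pow₀ hA₁) (one_le_pow₀ hA₀)
  have h5 : 0 ≤ ℓ ^ (2 * p₀) := Real.rpow_nonneg hℓ0.le _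
  calc (R ^ (d + 5))⁻¹ * (ℓ ^ p₁) ^ 2 ≤ ℓ ^ (2 * p₀) := h3
    _ ≤ A₁ ^ 2 * A₀ ^ 2 * ℓ ^ (2 * p₀) := le_mul_of_one_le_left h5 h4
    _ = A₁ ^ 2 * (A₀ * ℓ ^ p₀) ^ 2 := by rw [e2]; ring

/-- A factor `exp(−R_j^{−e}p₁²(g_j))` with a LOWER size power `e ≤ d + 5` is at most the largest factor (`R_j ≥ 1`): the monotonicity
behind print's comparison of the case-1 member `exp(−R_j⁻⁸p₁²(g_j))` (p. 382, `d = 4`) with `exp(−R_j^{−d−5}p₁²(g_j))`.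
[cite: Balaban1989LargeFieldII, p.382 (before (1.77)) with p.383 (after (1.78))] -/
theorem exp_Rpow_le_largest {p₁g R : ℝ} {e d : ℕ} (hR : 1 ≤ R) (he : e ≤ d + 5) :
    Real.exp (-((R ^ e)⁻¹ * p₁g ^ 2)) ≤ Real.exp (-(R ^ (d + 5))⁻¹ * p₁g ^ 2) :=
  exp_le_largest_of_coeff (inv_anti₀ (by positivity) (pow_le_pow_right₀ hR he))

/-- **p. 382, case 1 of `1 − χ′`**: its printed member `exp(−A₁²48⁻²R_j⁻⁸p₁²(g_j))` (`B16Sect1Statements.prep382_case1_factor`, the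
exponent `8` as printed at `d = 4`) is at most the largest factor `exp(−R_j^{−d−5}p₁²(g_j))`, for `R_j ≥ 1`, `A₁ ≥ 48` (the relation
behind print's own «≦ exp(−R_j⁻⁸p₁²(g_j))») and `3 ≤ d` (`8 ≤ d + 5`). [cite: Balaban1989LargeFieldII, p.382 (before (1.77)) with p.383 (after (1.78))] -/
theorem case1_le_largest {A₁ p₁g R : ℝ} {d : ℕ} (hR : 1 ≤ R) (hA : 48 ≤ A₁) (hd : 3 ≤ d) :
    Real.exp (-(A₁ ^ 2 * (48 ^ 2 : ℝ)⁻¹ * (R ^ 8)⁻¹ * p₁g ^ 2)) ≤ Real.exp (-(R ^ (d + 5))⁻¹ * p₁g ^ 2) := by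
  have hR8 : 0 < (R ^ 8)⁻¹ := inv_pos.mpr (by positivity)
  have key : (1 : ℝ) ≤ A₁ ^ 2 * (48 ^ 2 : ℝ)⁻¹ := by
    rw [show A₁ ^ 2 * (48 ^ 2 : ℝ)⁻¹ = A₁ ^ 2 / 48 ^ 2 by ring, le_div_iff₀ (by positivity)]
    nlinarith
  have h1 : (R ^ 8)⁻¹ ≤ A₁ ^ 2 * (48 ^ 2 : ℝ)⁻¹ * (R ^ 8)⁻¹ := le_mul_of_one_le_left hR8.le key
  have h2 : (R ^ (d + 5))⁻¹ ≤ (R ^ 8)⁻¹ := inv_anti₀ (by positivity) (pow_le_pow_right₀ hR (by omega))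
  rw [show A₁ ^ 2 * (48 ^ 2 : ℝ)⁻¹ * (R ^ 8)⁻¹ * p₁g ^ 2 = (A₁ ^ 2 * (48 ^ 2 : ℝ)⁻¹ * (R ^ 8)⁻¹) * p₁g ^ 2 by ring]
  exact exp_le_largest_of_coeff (h2.trans h1)

/-- **p. 383, case 2 of `1 − χ′` (the display after (1.78))**: its UNROUNDED left member
`exp(−½γ₀[6(d+3)(100M(L+1)N^{β₀}R_j)^{d+2}]⁻¹A₁²p₁²(g_j))` (`B16Sect1Kernels.lfFactor178`'s left member in the corrected reading
`p₁g′ = p₁g²`, slip note D-b02.7) is at most the largest factor `exp(−R_j^{−d−5}p₁²(g_j))` under the explicit largeness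
`12(d+3)(100M(L+1)N^{β₀})^{d+2} ≤ γ₀A₁²R_j³` (weak form of `lfFactor178_of_large`'s `hlarge`; `Nβ` = `N^{β₀}`, `R_j > 0`).
[cite: Balaban1989LargeFieldII, p.383 (after (1.78))] -/
theorem case2_le_largest {γ₀ A₁ p₁g R M L Nβ : ℝ} {d : ℕ} (hR : 0 < R) (hbase : 0 < 100 * M * (L + 1) * Nβ)
    (hlarge : 12 * (d + 3) * (100 * M * (L + 1) * Nβ) ^ (d + 2) ≤ γ₀ * A₁ ^ 2 * R ^ 3) :
    Real.exp (-(1 / 2) * γ₀ * (6 * (d + 3) * (100 * M * (L + 1) * Nβ * R) ^ (d + 2))⁻¹ * A₁ ^ 2 * p₁g ^ 2) ≤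
      Real.exp (-(R ^ (d + 5))⁻¹ * p₁g ^ 2) := by
  have hB : 0 < (100 * M * (L + 1) * Nβ) ^ (d + 2) := pow_pos hbase _
  have hW : 0 < 6 * ((d : ℝ) + 3) * (100 * M * (L + 1) * Nβ * R) ^ (d + 2) := by positivity
  have hR5 : 0 < R ^ (d + 5) := pow_pos hR _
  have key : (R ^ (d + 5))⁻¹ ≤ 1 / 2 * γ₀ * (6 * ((d : ℝ) + 3) * (100 * M * (L + 1) * Nβ * R) ^ (d + 2))⁻¹ * A₁ ^ 2 := by
    rw [show 1 / 2 * γ₀ * (6 * ((d : ℝ) + 3) * (100 * M * (L + 1) * Nβ * R) ^ (d + 2))⁻¹ * A₁ ^ 2 =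
        (γ₀ * A₁ ^ 2) / (12 * ((d : ℝ) + 3) * (100 * M * (L + 1) * Nβ * R) ^ (d + 2)) by
      field_simp; ring]
    rw [inv_eq_one_div, div_le_div_iff₀ hR5 (by positivity), one_mul]
    calc 12 * ((d : ℝ) + 3) * (100 * M * (L + 1) * Nβ * R) ^ (d + 2)
        = 12 * ((d : ℝ) + 3) * (100 * M * (L + 1) * Nβ) ^ (d + 2) * R ^ (d + 2) := by rw [mul_pow]; ring
      _ ≤ γ₀ * A₁ ^ 2 * R ^ 3 * R ^ (d + 2) := mul_le_mul_of_nonneg_right hlarge (pow_pos hR _).le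
      _ = γ₀ * A₁ ^ 2 * R ^ (d + 5) := by rw [show d + 5 = 3 + (d + 2) by omega, pow_add]; ring
  rw [show -(1 / 2) * γ₀ * (6 * ((d : ℝ) + 3) * (100 * M * (L + 1) * Nβ * R) ^ (d + 2))⁻¹ * A₁ ^ 2 * p₁g ^ 2 =
      -((1 / 2 * γ₀ * (6 * ((d : ℝ) + 3) * (100 * M * (L + 1) * Nβ * R) ^ (d + 2))⁻¹ * A₁ ^ 2) * p₁g ^ 2) by ring]
  exact exp_le_largest_of_coeff key

/-! ## §2 «This is the largest factor among all the small factors»: the sentence for a factor of any of the five kinds -/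

/-- **p. 383 after (1.78), «This is the largest factor among all the small factors we have obtained from the large field characteristic
functions in the preparatory steps», PROVED**: a real number `f` bounded by ANY of the five printed members of pp. 381–383 — `1 − χ_j^{(n)}`
or `1 − χ_{j,Λ}` (`exp(−A₁²p₀²(g_j))`), `1 − χ′_m` (`exp(−γ₀A₁²p₁²(g_j))`), `1 − χ′` case 1 (`exp(−A₁²48⁻²R_j⁻⁸p₁²(g_j))`), `1 − χ′` case 2
(the unrounded member of the display after (1.78)) — is at most `exp(−R_j^{−d−5}p₁²(g_j))`, under the explicit side conditions of §1
(`hcmp` by `cmp_of_order` or `cmp_of_exponents`).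
[cite: Balaban1989LargeFieldII, p.383 (after (1.78))] -/
theorem le_largest_of_kinds {f γ₀ A₁ p₀g p₁g R M L Nβ : ℝ} {d : ℕ} (hR : 1 ≤ R) (hd : 3 ≤ d)
    (hcmp : (R ^ (d + 5))⁻¹ * p₁g ^ 2 ≤ A₁ ^ 2 * p₀g ^ 2) (hγA : 1 ≤ γ₀ * A₁ ^ 2) (hA : 48 ≤ A₁)
    (hbase : 0 < 100 * M * (L + 1) * Nβ)
    (hlarge : 12 * (d + 3) * (100 * M * (L + 1) * Nβ) ^ (d + 2) ≤ γ₀ * A₁ ^ 2 * R ^ 3)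
    (hk : f ≤ Real.exp (-(A₁ ^ 2 * p₀g ^ 2)) ∨ f ≤ Real.exp (-(γ₀ * A₁ ^ 2 * p₁g ^ 2)) ∨
      f ≤ Real.exp (-(A₁ ^ 2 * (48 ^ 2 : ℝ)⁻¹ * (R ^ 8)⁻¹ * p₁g ^ 2)) ∨
      f ≤ Real.exp (-(1 / 2) * γ₀ * (6 * (d + 3) * (100 * M * (L + 1) * Nβ * R) ^ (d + 2))⁻¹ * A₁ ^ 2 * p₁g ^ 2)) :
    f ≤ Real.exp (-(R ^ (d + 5))⁻¹ * p₁g ^ 2) := by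
  rcases hk with h | h | h | h
  · exact h.trans (chi_n_le_largest hcmp)
  · exact h.trans (chi'm_le_largest hR hγA)
  · exact h.trans (case1_le_largest hR hA hd)
  · exact h.trans (case2_le_largest (by linarith) hbase hlarge)

/-! ## §3 The junction with (P) of `B16StepFactorsPrinted.StepDisplaysAt`: carriers whose primed components carry printed factors -/

/-- **(P) FROM THE FIVE PRINTED FACTORS, PER COMPONENT KIND.**  For one-step carriers `X` of the run `D` at step `j` and the letters `c`
(`B16StepFactorsPrinted.Consts`: `γ₀`, `A₀`, `p₀`, `A₁`, `d`, profiles `R`, `P1`), read at `g_j = D.flow.g j` (IR-100-2's INDEX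
CONVENTION for the renewals an operation performs): if every primed component's preparatory factor is nonnegative and bounded by ONE of
the five printed members at `p₀(g_j) = p0Profile A₀ p₀ g_j`, `p₁(g_j) = P1 g_j`, `R_j = R g_j` (which kind occurred is the consumer's
DATA, `hkind`), then under §1's side conditions (the exponent comparison `hcmp` at the letters `c.R`, `c.P1`, `p0Profile c.A₀ c.p₀`,
discharged by `cmp_of_order` ∕ `cmp_of_exponents`) the (P)-conjunct of `StepDisplaysAt D j X c` holds LETTER FOR LETTER:
`0 ≤ lfPrep ∧ lfPrep ≤ exp(−R(g_j)^{−(d+5)}·P1(g_j)²)`.  An implication between hypothesis shapes; nothing of Bałaban's asserted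
(that the preparatory characteristic functions DO yield these factors is [IV] §1 + (1.77)–(1.78), under audit).
[cite: Balaban1989LargeFieldII, p.383 (after (1.78)) with pp.381-382] -/
theorem prep_conjunct_of_kinds {D : B16.RunData} {j : ℕ} (X : StepCarriers D j) (c : B16StepFactorsPrinted.Consts) {L Nβ : ℝ}
    (hR : 1 ≤ c.R (D.flow.g j)) (hd : 3 ≤ c.d)
    (hcmp : (c.R (D.flow.g j) ^ (c.d + 5))⁻¹ * c.P1 (D.flow.g j) ^ 2 ≤ c.A₁ ^ 2 * p0Profile c.A₀ c.p₀ (D.flow.g j) ^ 2)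
    (hγA : 1 ≤ c.γ₀ * c.A₁ ^ 2)
    (hA : 48 ≤ c.A₁) (hbase : 0 < 100 * c.M * (L + 1) * Nβ)
    (hlarge : 12 * (c.d + 3) * (100 * c.M * (L + 1) * Nβ) ^ (c.d + 2) ≤ c.γ₀ * c.A₁ ^ 2 * c.R (D.flow.g j) ^ 3)
    (hkind : ∀ p, ∀ i ∈ X.primed p, 0 ≤ X.lfPrep p i ∧
      (X.lfPrep p i ≤ Real.exp (-(c.A₁ ^ 2 * p0Profile c.A₀ c.p₀ (D.flow.g j) ^ 2)) ∨
        X.lfPrep p i ≤ Real.exp (-(c.γ₀ * c.A₁ ^ 2 * c.P1 (D.flow.g j) ^ 2)) ∨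
        X.lfPrep p i ≤ Real.exp (-(c.A₁ ^ 2 * (48 ^ 2 : ℝ)⁻¹ * (c.R (D.flow.g j) ^ 8)⁻¹ * c.P1 (D.flow.g j) ^ 2)) ∨
        X.lfPrep p i ≤ Real.exp (-(1 / 2) * c.γ₀ *
          (6 * (c.d + 3) * (100 * c.M * (L + 1) * Nβ * c.R (D.flow.g j)) ^ (c.d + 2))⁻¹ * c.A₁ ^ 2 *
            c.P1 (D.flow.g j) ^ 2))) :
    ∀ p, ∀ i ∈ X.primed p, 0 ≤ X.lfPrep p i ∧
      X.lfPrep p i ≤ Real.exp (-(c.R (D.flow.g j) ^ (c.d + 5))⁻¹ * c.P1 (D.flow.g j) ^ 2) := fun p i hi =>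
  ⟨(hkind p i hi).1, le_largest_of_kinds hR hd hcmp hγA hA hbase hlarge (hkind p i hi).2⟩

/-- Shape sanity (zero weight): the (P)-conjunct `prep_conjunct_of_kinds` concludes IS the fourth conjunct of `StepDisplaysAt D j X c`
(so a consumer rebuilds `StepDisplaysAt` from (Y), (V), (F), (I) and the per-kind data). [cite: Balaban1989LargeFieldII, p.383 (after (1.78))] -/
example {D : B16.RunData} {j : ℕ} (X : StepCarriers D j) (c : B16StepFactorsPrinted.Consts) (h : StepDisplaysAt D j X c) :
    ∀ p, ∀ i ∈ X.primed p, 0 ≤ X.lfPrep p i ∧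
      X.lfPrep p i ≤ Real.exp (-(c.R (D.flow.g j) ^ (c.d + 5))⁻¹ * c.P1 (D.flow.g j) ^ 2) :=
  h.2.2.2.1

end

end Literature.MathematicalPhysics.QuantumFieldTheory.Balaban1983to89.B16PrepFactorsLargest383
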